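import Summits.QuantumFields.BalabanUV.Beta.D1BFx.NeedleNdlDipByParts
import Summits.QuantumFields.BalabanUV.Beta.D1BFx.NeedleDipProjPointwise
import Summits.QuantumFields.BalabanUV.Beta.D1BFx.FineHessianSectors

/-!
# `BalabanUV.Beta.D1BFx.NeedleNdlDipWord` — road «BF-x» for binder row D1, slot (K), END row `hGrp gN`, «GN-33 ∕ NK+KN» PART 4: THE `ndl ⊗ dip`
# WORD OF THE GLUON NEEDLE ROW T₃ AT NEEDLE BOND `(κ,u)`, DIP BOND `(κ′,v)` AS SIXTEEN PAIRINGS, AND ITS POINTWISE BOUND FROM ABSTRACT LETTERS —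
# `|biBubbleTable Ga Ga (ndlPiece cQ) dipPiece κ κ′ u v| ≤ Σ_{s∈B(blk u)} |qJet_u s|·(A₁·e^{−(δ∕4n)‖s−v‖}∕nrm(s−v) + A₀·e^{−(δ∕4n)‖s−v‖})`

HONEST DEPENDENCY (cell records, verbatim): «continuum YM on T⁴ ⇐ BetaPertH ∧ nine spine estimates (0/9 proved); BetaPertH ⇐ (D1) ∧ (D4) ∧
CAP+tail; G-an2-4 gates asym, D1 and NE2/3/4.»  HONEST FRAMING (cell contract, verbatim): «discharging `BetaPertH` makes Bałaban's UV stability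
UNCONDITIONAL — a real constructive-QFT result; it is NOT the continuum limit and NOT the Clay problem.»  THIS MODULE DISCHARGES NOTHING of the
wall: [folklore] algebra over the owner's `NeedleDipShape.bubble_dip_expand_right` ∕ `locV_rho` ∕ `locV_drho` ∕ `locV_p` ∕ `locV_dp`, `NeedleNdlShape.bubble_ndl_dSw` ∕
`loc_ndlPiece'`, leaf-03's `FineHessianSectors.biBubbleTable_apply`, `PackedKernelSplit.bubble_eq_biBubble`, leaf-04-g10's `NeedleDipProjPointwise.abs_comb8_le`.
The sixteen letter bounds are HYPOTHESES here (abstract nonnegative constants), fed in `NeedleNdlDipRow` by `NeedleNdlDipRowLetters` ∕ `NeedleNdlDipColLetters` ∕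
`NeedleNdlDipByParts` and the profile letters of the leg ∕ needle ∕ column ∕ dip functions (modulo [B5, Prop. 1.2] ∧ [B5, (1.126)–(1.127)] BY NAME there).
No `def`, no `def … : Prop`, nothing cited, 0 sorry.  Root-level binders hW ∕ hR-sockets ∕ hSX-socket ∕ D1Tel ∕ D1Rep — 0 discharged; (K) NOT closed;
NOT D1, NOT `BetaPertH`, NOT continuum, NOT Clay.

ABSOLUTE RULE (cell charter, verbatim): «No internally-minted statement may enter as a cited fact. Every hypothesis is either kernel-proved in
this package or a verbatim quotation of a PUBLISHED theorem with page reference. The manuscript(s) under audit are NOT citable for their own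
disputed steps — they are the thing under adjudication; programme-internal (2001/route/tribunal) claims are never citable.»

WHY (owner d1-p2 gen 11 RULING ρ-g11-2 ∕ ρ-g11-3; my statement line l.31599).  `bubble Ga (ndlPiece_{κ,u}) (dipPiece_{κ′,v})
= T(δρ_v, p_v) + T(ρ_v, δp_v) − T(p_v, δρ_v) − T(δp_v, ρ_v)`, `T(f,g) = S1(f)·S2(g) − S3(f)·S4(g)`, `S1(f) = ⟨∇row_u, Ga∇f⟩`, `S2(g) = ⟨Ga∇C_u, ∇g⟩`,
`S3(f) = ⟨∇C_u, Ga∇f⟩`, `S4(g) = ⟨Ga∇row_u, ∇g⟩` (`ρ_v(x) = RG(x,v)`, `δρ_v = RG(·,v+e_{κ′}) − RG(·,v)`, `p_v(q) = P(v,q)`, `δp_v = P(v,·) − P(v+e_{κ′},·)`).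
In every pair `(f,g)` exactly one function is FLAT (`p`, `δp`): its pairing carries the site damping, the other carries the needle profile; the eight
products land in two envelopes `W₁ = Σ_s|q_u s|·e₄(s−v)∕nrm(s−v)` and `W₀ = Σ_s|q_u s|·e₄(s−v)` (`e₄ = e^{−(δ∕4n)‖·‖}`; a damping in `u − v` is moved to
the needle site `s ∈ B(blk u)` at the price `e^{δ∕4}`, `‖u−s‖∞ ≤ n−1`).  COUNT (fed constants): `A₁ ~ n⁻⁴`, `A₀ ~ n⁻⁵` before the ray weight `cK ~ n²`.
* §1 [folklore] `exp_partner_le` (damping moved from the bond to a site of its block), `supNorm_sub_le_of_mem_B`.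
* §2 [folklore] **`abs_ndlDip_word_le`**.
NOT HERE (honest): the census ∕ base average ∕ the cells `hnd`, `hdn` (`NeedleNdlDipRow`, `NeedleDipNdlRow`).
Unit `b2b-balaban-beta-d1-formalise-leaf-01` (gen 15), D1 formalisation swarm LEAF PROVER 01; `LEAVES-BFx.md` row (N) «GN-33∕NK+KN» part 4.
-/

noncomputable section

namespace Summit.QuantumFields.BalabanUV.Beta.D1BFx.NeedleNdlDipWord

open Finset
open scoped BigOperators
open Literature.MathematicalPhysics.QuantumFieldTheory.Balaban1983to89
open Literature.MathematicalPhysics.QuantumFieldTheory.Balaban1983to89.Beta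
open B6QGQLower276 (X e blk B mem_B dist_le_of_blk_eq)
open ExpKernelCalculus (Site MKer bubble)
open DyadicShell (Pt)
open AffineAveraging (unitVec)
open Beta.PoissonInterior (nrm nrm_pos nrm_neg)
open Summit.QuantumFields.BalabanUV.Beta.TameKernelCalculus (Spr Loc)
open Summit.QuantumFields.BalabanUV.Beta.D1BFx.RProjector (Pgt kerP)
open Summit.QuantumFields.BalabanUV.Beta.D1BFx.GhostLeg (Ggh)
open Summit.QuantumFields.BalabanUV.Beta.D1BFx.RProjectorJet (RG)
open Summit.QuantumFields.BalabanUV.Beta.D1BFx.GluonLeg (Ga)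
open Summit.QuantumFields.BalabanUV.Beta.D1BFx.GhostStencil (qJet)
open Summit.QuantumFields.BalabanUV.Beta.D1BFx.NeedlePotentialLetters (ndlRow)
open Summit.QuantumFields.BalabanUV.Beta.D1BFx.RJetAssembly (dSw)
open Summit.QuantumFields.BalabanUV.Beta.D1BFx.GluonNeedleSplit (dipPiece ndlPiece)
open Summit.QuantumFields.BalabanUV.Beta.D1BFx.PackedKernelSplit (biBubble bubble_eq_biBubble)
open Summit.QuantumFields.BalabanUV.Beta.D1BFx.FineHessianSectors (biBubbleTable biBubbleTable_apply)
open Summit.QuantumFields.BalabanUV.Beta.D1BFx.RankOneBubble (applyK pairing)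
open Summit.QuantumFields.BalabanUV.Beta.D1BFx.RankOneBubbleJets (grad tensor)
open Summit.QuantumFields.BalabanUV.Beta.D1BFx.NeedleNdlShape (bubble_ndl_dSw loc_ndlPiece')
open Summit.QuantumFields.BalabanUV.Beta.D1BFx.NeedleDipShape (bubble_dip_expand_right locV_rho locV_drho locV_p locV_dp)
open Summit.QuantumFields.BalabanUV.Beta.D1BFx.NeedleDipProjPointwise (abs_comb8_le)
open Summit.QuantumFields.BalabanUV.Beta.D1BFx.GhostLegBlockMass (dist_eq_supNorm)
open Summit.QuantumFields.BalabanUV.Beta.D1BFx.LatticeHLSProfiles (supNorm_dyadic)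

variable (n : ℕ) [NeZero n] (a : ℝ)

/-! ## §1 Moving a site damping from the bond to a site of its block -/

omit [NeZero n] in
/-- [folklore] two sites of one block are at sup distance `≤ n − 1 ≤ n`. -/
theorem supNorm_sub_le_of_mem_B {u s : Pt} (hs : s ∈ B (n - 1) (blk (n - 1) u)) : (Beta.PoissonInterior.supNorm (u - s) : ℝ) ≤ n := by
  have hu : u ∈ B (n - 1) (blk (n - 1) u) := mem_B.2 rfl
  have h := dist_le_of_blk_eq (n := n - 1) (p := u) (q := s) (by rw [mem_B.1 hu, mem_B.1 hs])
  rw [dist_eq_supNorm, supNorm_dyadic] at h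
  exact h.trans (by exact_mod_cast Nat.sub_le n 1)

/-- [folklore] **DAMPING MOVED TO THE NEEDLE SITE**: for `s ∈ B(blk u)`, `e^{−(δ∕4n)‖u−v‖} ≤ e^{δ∕4}·e^{−(δ∕4n)‖s−v‖}` (`‖s−v‖ ≤ ‖s−u‖ + ‖u−v‖`, `‖u−s‖ ≤ n`). -/
theorem exp_partner_le {δ : ℝ} (hδ : 0 ≤ δ) {u s : Pt} (hs : s ∈ B (n - 1) (blk (n - 1) u)) (v : Pt) :
    Real.exp (-(δ / 4 / n) * Beta.PoissonInterior.supNorm (u - v)) ≤ Real.exp (δ / 4) * Real.exp (-(δ / 4 / n) * Beta.PoissonInterior.supNorm (s - v)) := by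
  have hn : (0 : ℝ) < n := by exact_mod_cast Nat.pos_of_ne_zero (NeZero.ne n)
  have h1 := supNorm_sub_le_of_mem_B n hs
  have h2 : (Beta.PoissonInterior.supNorm (s - v) : ℝ) ≤ Beta.PoissonInterior.supNorm (s - u) + Beta.PoissonInterior.supNorm (u - v) := by
    have h := Beta.PoissonInterior.supNorm_add_le (d := 4) (s - u) (u - v)
    rw [show s - u + (u - v) = s - v by abel] at h
    exact_mod_cast h
  have h3 : (Beta.PoissonInterior.supNorm (s - u) : ℝ) = Beta.PoissonInterior.supNorm (u - s) := by
    rw [show s - u = -(u - s) by abel, PoissonInterior.supNorm_neg]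
  rw [h3] at h2
  rw [← Real.exp_add]
  refine Real.exp_le_exp.2 ?_
  have hδn : 0 ≤ δ / 4 / n := by positivity
  have h4 : δ / 4 / n * (Beta.PoissonInterior.supNorm (s - v) : ℝ) ≤ δ / 4 / n * n + δ / 4 / n * Beta.PoissonInterior.supNorm (u - v) := by
    calc δ / 4 / n * (Beta.PoissonInterior.supNorm (s - v) : ℝ)
        ≤ δ / 4 / n * (Beta.PoissonInterior.supNorm (u - s) + Beta.PoissonInterior.supNorm (u - v)) := mul_le_mul_of_nonneg_left h2 hδn
      _ ≤ δ / 4 / n * (n + Beta.PoissonInterior.supNorm (u - v)) := mul_le_mul_of_nonneg_left (add_le_add h1 le_rfl) hδn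
      _ = _ := by ring
  have h5 : δ / 4 / n * (n : ℝ) = δ / 4 := by field_simp
  rw [h5] at h4
  linarith

/-! ## §2 The word as sixteen pairings and its pointwise bound -/

section Word

variable {n a}

/-- [folklore] **THE `ndl ⊗ dip` WORD AT NEEDLE BOND `(κ,u)`, DIP BOND `(κ′,v)`, BOUNDED FROM THE SIXTEEN ABSTRACT LETTERS**: with needle-row letters
`S1`∕`S4` (`h11`…`h14`, `h41`…`h44`: dipole `K·W₁`-shape, Coulomb `K·Σ|q|∕nrm`, flat `K·W₀`-shape) and column letters `S2`∕`S3` (`h21`…`h24`, `h31`…`h34`: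
constants, the flat ∕ Coulomb ones damped by `e₄(u−v)`), for every `κ κ′ u v`:
`|biBubbleTable Ga Ga (ndlPiece cQ) dipPiece κ κ′ u v| ≤ Σ_{s∈B(blk u)} |qJet_u s|·(A₁·e₄(s−v)∕nrm(s−v) + A₀·e₄(s−v))`,
`A₁ = K11K23 + K33K41 + e^{δ∕4}(K12K24 + K34K42)`, `A₀ = K31K43 + K32K44 + K13K21 + K14K22`. -/
theorem abs_ndlDip_word_le (ha : 0 < a) (hA : Spr (Ga n a)) {cQ δ K11 K12 K13 K14 K41 K42 K43 K44 K21 K22 K23 K24 K31 K32 K33 K34 : ℝ}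
    (hδ : 0 ≤ δ) (hK11 : 0 ≤ K11) (hK12 : 0 ≤ K12) (hK13 : 0 ≤ K13) (hK14 : 0 ≤ K14) (hK41 : 0 ≤ K41) (hK42 : 0 ≤ K42)
    (hK43 : 0 ≤ K43) (hK44 : 0 ≤ K44) (hK22 : 0 ≤ K22) (hK23 : 0 ≤ K23) (hK24 : 0 ≤ K24) (hK31 : 0 ≤ K31) (hK32 : 0 ≤ K32) (hK33 : 0 ≤ K33) (hK34 : 0 ≤ K34)
    (h11 : ∀ (κ : Fin 4) (u : Pt) (κ' : Fin 4) (v : Pt), |pairing (grad (ndlRow n a κ u))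
        (applyK (Ga n a) (grad (fun x => RG (Ggh n a) (Pgt n a) x (v + unitVec κ') () () - RG (Ggh n a) (Pgt n a) x v () ())))|
      ≤ K11 * ∑ s ∈ B (n - 1) (blk (n - 1) u), |qJet n κ u (blk (n - 1) u) s| *
          (Real.exp (-(δ / 4 / n) * Beta.PoissonInterior.supNorm (s - v)) / nrm (s - v)))
    (h12 : ∀ (κ : Fin 4) (u v : Pt), |pairing (grad (ndlRow n a κ u)) (applyK (Ga n a) (grad (fun x => RG (Ggh n a) (Pgt n a) x v () ())))|
      ≤ K12 * ∑ s ∈ B (n - 1) (blk (n - 1) u), |qJet n κ u (blk (n - 1) u) s| / nrm (s - v))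
    (h13 : ∀ (κ : Fin 4) (u v : Pt), |pairing (grad (ndlRow n a κ u)) (applyK (Ga n a) (grad (fun q => Pgt n a v q () ())))|
      ≤ K13 * ∑ s ∈ B (n - 1) (blk (n - 1) u), |qJet n κ u (blk (n - 1) u) s| * Real.exp (-(δ / 4 / n) * Beta.PoissonInterior.supNorm (s - v)))
    (h14 : ∀ (κ : Fin 4) (u : Pt) (κ' : Fin 4) (v : Pt), |pairing (grad (ndlRow n a κ u))
        (applyK (Ga n a) (grad (fun q => Pgt n a v q () () - Pgt n a (v + unitVec κ') q () ())))|
      ≤ K14 * ∑ s ∈ B (n - 1) (blk (n - 1) u), |qJet n κ u (blk (n - 1) u) s| * Real.exp (-(δ / 4 / n) * Beta.PoissonInterior.supNorm (s - v)))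
    (h41 : ∀ (κ : Fin 4) (u : Pt) (κ' : Fin 4) (v : Pt), |pairing (applyK (Ga n a) (grad (ndlRow n a κ u)))
        (grad (fun x => RG (Ggh n a) (Pgt n a) x (v + unitVec κ') () () - RG (Ggh n a) (Pgt n a) x v () ()))|
      ≤ K41 * ∑ s ∈ B (n - 1) (blk (n - 1) u), |qJet n κ u (blk (n - 1) u) s| *
          (Real.exp (-(δ / 4 / n) * Beta.PoissonInterior.supNorm (s - v)) / nrm (s - v)))
    (h42 : ∀ (κ : Fin 4) (u v : Pt), |pairing (applyK (Ga n a) (grad (ndlRow n a κ u))) (grad (fun x => RG (Ggh n a) (Pgt n a) x v () ()))|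
      ≤ K42 * ∑ s ∈ B (n - 1) (blk (n - 1) u), |qJet n κ u (blk (n - 1) u) s| / nrm (s - v))
    (h43 : ∀ (κ : Fin 4) (u v : Pt), |pairing (applyK (Ga n a) (grad (ndlRow n a κ u))) (grad (fun q => Pgt n a v q () ()))|
      ≤ K43 * ∑ s ∈ B (n - 1) (blk (n - 1) u), |qJet n κ u (blk (n - 1) u) s| * Real.exp (-(δ / 4 / n) * Beta.PoissonInterior.supNorm (s - v)))
    (h44 : ∀ (κ : Fin 4) (u : Pt) (κ' : Fin 4) (v : Pt), |pairing (applyK (Ga n a) (grad (ndlRow n a κ u)))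
        (grad (fun q => Pgt n a v q () () - Pgt n a (v + unitVec κ') q () ()))|
      ≤ K44 * ∑ s ∈ B (n - 1) (blk (n - 1) u), |qJet n κ u (blk (n - 1) u) s| * Real.exp (-(δ / 4 / n) * Beta.PoissonInterior.supNorm (s - v)))
    (h21 : ∀ (u : Pt) (κ' : Fin 4) (v : Pt), |pairing
        (applyK (Ga n a) (grad (fun q => cQ * (∑ z ∈ B (n - 1) (blk (n - 1) u), Pgt n a z q () ()) - kerP (d := 4) (n - 1) a q (blk (n - 1) u))))
        (grad (fun x => RG (Ggh n a) (Pgt n a) x (v + unitVec κ') () () - RG (Ggh n a) (Pgt n a) x v () ()))| ≤ K21)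
    (h22 : ∀ (u v : Pt), |pairing
        (applyK (Ga n a) (grad (fun q => cQ * (∑ z ∈ B (n - 1) (blk (n - 1) u), Pgt n a z q () ()) - kerP (d := 4) (n - 1) a q (blk (n - 1) u))))
        (grad (fun x => RG (Ggh n a) (Pgt n a) x v () ()))| ≤ K22 * Real.exp (-(δ / 4 / n) * Beta.PoissonInterior.supNorm (u - v)))
    (h23 : ∀ (u v : Pt), |pairing
        (applyK (Ga n a) (grad (fun q => cQ * (∑ z ∈ B (n - 1) (blk (n - 1) u), Pgt n a z q () ()) - kerP (d := 4) (n - 1) a q (blk (n - 1) u))))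
        (grad (fun q => Pgt n a v q () ()))| ≤ K23 * Real.exp (-(δ / 4 / n) * Beta.PoissonInterior.supNorm (u - v)))
    (h24 : ∀ (u : Pt) (κ' : Fin 4) (v : Pt), |pairing
        (applyK (Ga n a) (grad (fun q => cQ * (∑ z ∈ B (n - 1) (blk (n - 1) u), Pgt n a z q () ()) - kerP (d := 4) (n - 1) a q (blk (n - 1) u))))
        (grad (fun q => Pgt n a v q () () - Pgt n a (v + unitVec κ') q () ()))| ≤ K24 * Real.exp (-(δ / 4 / n) * Beta.PoissonInterior.supNorm (u - v)))
    (h31 : ∀ (u : Pt) (κ' : Fin 4) (v : Pt), |pairing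
        (grad (fun q => cQ * (∑ z ∈ B (n - 1) (blk (n - 1) u), Pgt n a z q () ()) - kerP (d := 4) (n - 1) a q (blk (n - 1) u)))
        (applyK (Ga n a) (grad (fun x => RG (Ggh n a) (Pgt n a) x (v + unitVec κ') () () - RG (Ggh n a) (Pgt n a) x v () ())))|
      ≤ K31 * Real.exp (-(δ / 4 / n) * Beta.PoissonInterior.supNorm (u - v)))
    (h32 : ∀ (u v : Pt), |pairing
        (grad (fun q => cQ * (∑ z ∈ B (n - 1) (blk (n - 1) u), Pgt n a z q () ()) - kerP (d := 4) (n - 1) a q (blk (n - 1) u)))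
        (applyK (Ga n a) (grad (fun x => RG (Ggh n a) (Pgt n a) x v () ())))| ≤ K32 * Real.exp (-(δ / 4 / n) * Beta.PoissonInterior.supNorm (u - v)))
    (h33 : ∀ (u v : Pt), |pairing
        (grad (fun q => cQ * (∑ z ∈ B (n - 1) (blk (n - 1) u), Pgt n a z q () ()) - kerP (d := 4) (n - 1) a q (blk (n - 1) u)))
        (applyK (Ga n a) (grad (fun q => Pgt n a v q () ())))| ≤ K33 * Real.exp (-(δ / 4 / n) * Beta.PoissonInterior.supNorm (u - v)))
    (h34 : ∀ (u : Pt) (κ' : Fin 4) (v : Pt), |pairing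
        (grad (fun q => cQ * (∑ z ∈ B (n - 1) (blk (n - 1) u), Pgt n a z q () ()) - kerP (d := 4) (n - 1) a q (blk (n - 1) u)))
        (applyK (Ga n a) (grad (fun q => Pgt n a v q () () - Pgt n a (v + unitVec κ') q () ())))|
      ≤ K34 * Real.exp (-(δ / 4 / n) * Beta.PoissonInterior.supNorm (u - v)))
    (κ κ' : Fin 4) (u v : Pt) :
    |biBubbleTable (Ga n a) (Ga n a) (ndlPiece n a cQ) (dipPiece n a) κ κ' u v|
      ≤ ∑ s ∈ B (n - 1) (blk (n - 1) u), |qJet n κ u (blk (n - 1) u) s| *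
          ((K11 * K23 + K33 * K41 + Real.exp (δ / 4) * (K12 * K24 + K34 * K42)) *
              (Real.exp (-(δ / 4 / n) * Beta.PoissonInterior.supNorm (s - v)) / nrm (s - v))
            + (K31 * K43 + K32 * K44 + K13 * K21 + K14 * K22) * Real.exp (-(δ / 4 / n) * Beta.PoissonInterior.supNorm (s - v))) := by
  set m : ℕ := n - 1 with hm
  -- the expansion into four tensor words and sixteen pairings
  rw [biBubbleTable_apply, ← bubble_eq_biBubble, bubble_dip_expand_right ha hA (loc_ndlPiece' n a cQ κ u ha) κ' v,
    bubble_ndl_dSw ha hA (locV_drho n a κ' v ha) (locV_p n a v ha), bubble_ndl_dSw ha hA (locV_rho n a v ha) (locV_dp n a κ' v ha),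
    bubble_ndl_dSw ha hA (locV_p n a v ha) (locV_drho n a κ' v ha), bubble_ndl_dSw ha hA (locV_dp n a κ' v ha) (locV_rho n a v ha)]
  -- the three envelope sums and the bond damping
  set W₁ : ℝ := ∑ s ∈ B m (blk m u), |qJet n κ u (blk m u) s| * (Real.exp (-(δ / 4 / n) * Beta.PoissonInterior.supNorm (s - v)) / nrm (s - v)) with hW₁
  set W₀ : ℝ := ∑ s ∈ B m (blk m u), |qJet n κ u (blk m u) s| * Real.exp (-(δ / 4 / n) * Beta.PoissonInterior.supNorm (s - v)) with hW₀
  set Wn : ℝ := ∑ s ∈ B m (blk m u), |qJet n κ u (blk m u) s| / nrm (s - v) with hWn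
  set E : ℝ := Real.exp (-(δ / 4 / n) * Beta.PoissonInterior.supNorm (u - v)) with hE
  have hW₁0 : 0 ≤ W₁ := Finset.sum_nonneg fun s _ => by have := nrm_pos (s - v); positivity
  have hW₀0 : 0 ≤ W₀ := Finset.sum_nonneg fun s _ => by positivity
  have hWn0 : 0 ≤ Wn := Finset.sum_nonneg fun s _ => by have := nrm_pos (s - v); positivity
  have hE0 : 0 ≤ E := (Real.exp_pos _).le
  have hE1 : E ≤ 1 := by
    rw [hE, Real.exp_le_one_iff]
    have : (0 : ℝ) ≤ δ / 4 / n * Beta.PoissonInterior.supNorm (u - v) := by positivity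
    linarith
  have hEWn : E * Wn ≤ Real.exp (δ / 4) * W₁ := by
    rw [hWn, hW₁, Finset.mul_sum, Finset.mul_sum]
    refine Finset.sum_le_sum fun s hs => ?_
    have hns := nrm_pos (s - v)
    have h := exp_partner_le n hδ hs v
    calc E * (|qJet n κ u (blk m u) s| / nrm (s - v)) = (|qJet n κ u (blk m u) s| / nrm (s - v)) * E := mul_comm _ _
      _ ≤ (|qJet n κ u (blk m u) s| / nrm (s - v)) * (Real.exp (δ / 4) * Real.exp (-(δ / 4 / n) * Beta.PoissonInterior.supNorm (s - v))) :=
          mul_le_mul_of_nonneg_left h (by positivity)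
      _ = _ := by ring
  -- the sixteen letters at this (κ, u, κ', v)
  have l11 := h11 κ u κ' v; have l12 := h12 κ u v; have l13 := h13 κ u v; have l14 := h14 κ u κ' v
  have l41 := h41 κ u κ' v; have l42 := h42 κ u v; have l43 := h43 κ u v; have l44 := h44 κ u κ' v
  have l21 := h21 u κ' v; have l22 := h22 u v; have l23 := h23 u v; have l24 := h24 u κ' v
  have l31 := h31 u κ' v; have l32 := h32 u v; have l33 := h33 u v; have l34 := h34 u κ' v
  rw [← hW₁] at l11 l41; rw [← hWn] at l12 l42; rw [← hW₀] at l13 l14 l43 l44; rw [← hE] at l22 l23 l24 l31 l32 l33 l34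
  -- the eight products
  have e22 : K22 * E ≤ K22 := mul_le_of_le_one_right hK22 hE1
  have e23 : K23 * E ≤ K23 := mul_le_of_le_one_right hK23 hE1
  have r1 := (mul_le_mul l11 l23 (abs_nonneg _) (mul_nonneg hK11 hW₁0)).trans
    ((mul_le_mul_of_nonneg_left e23 (mul_nonneg hK11 hW₁0)).trans (le_of_eq (show K11 * W₁ * K23 = K11 * K23 * W₁ by ring)))
  have r2 := (mul_le_mul l31 l43 (abs_nonneg _) (mul_nonneg hK31 hE0)).trans
    ((le_of_eq (show K31 * E * (K43 * W₀) = K31 * K43 * W₀ * E by ring)).trans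
      (mul_le_of_le_one_right (mul_nonneg (mul_nonneg hK31 hK43) hW₀0) hE1))
  have r3 := (mul_le_mul l12 l24 (abs_nonneg _) (mul_nonneg hK12 hWn0)).trans
    ((le_of_eq (show K12 * Wn * (K24 * E) = K12 * K24 * (E * Wn) by ring)).trans
      ((mul_le_mul_of_nonneg_left hEWn (mul_nonneg hK12 hK24)).trans (le_of_eq (show K12 * K24 * (Real.exp (δ / 4) * W₁)
        = Real.exp (δ / 4) * (K12 * K24) * W₁ by ring))))
  have r4 := (mul_le_mul l32 l44 (abs_nonneg _) (mul_nonneg hK32 hE0)).trans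
    ((le_of_eq (show K32 * E * (K44 * W₀) = K32 * K44 * W₀ * E by ring)).trans
      (mul_le_of_le_one_right (mul_nonneg (mul_nonneg hK32 hK44) hW₀0) hE1))
  have r5 := (mul_le_mul l13 l21 (abs_nonneg _) (mul_nonneg hK13 hW₀0)).trans (le_of_eq (show K13 * W₀ * K21 = K13 * K21 * W₀ by ring))
  have r6 := (mul_le_mul l33 l41 (abs_nonneg _) (mul_nonneg hK33 hE0)).trans
    ((le_of_eq (show K33 * E * (K41 * W₁) = K33 * K41 * W₁ * E by ring)).trans
      (mul_le_of_le_one_right (mul_nonneg (mul_nonneg hK33 hK41) hW₁0) hE1))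
  have r7 := (mul_le_mul l14 l22 (abs_nonneg _) (mul_nonneg hK14 hW₀0)).trans
    ((mul_le_mul_of_nonneg_left e22 (mul_nonneg hK14 hW₀0)).trans (le_of_eq (show K14 * W₀ * K22 = K14 * K22 * W₀ by ring)))
  have r8 := (mul_le_mul l34 l42 (abs_nonneg _) (mul_nonneg hK34 hE0)).trans
    ((le_of_eq (show K34 * E * (K42 * Wn) = K34 * K42 * (E * Wn) by ring)).trans
      ((mul_le_mul_of_nonneg_left hEWn (mul_nonneg hK34 hK42)).trans (le_of_eq (show K34 * K42 * (Real.exp (δ / 4) * W₁)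
        = Real.exp (δ / 4) * (K34 * K42) * W₁ by ring))))
  have hRHS : ∑ s ∈ B m (blk m u), |qJet n κ u (blk m u) s| *
      ((K11 * K23 + K33 * K41 + Real.exp (δ / 4) * (K12 * K24 + K34 * K42)) *
          (Real.exp (-(δ / 4 / n) * Beta.PoissonInterior.supNorm (s - v)) / nrm (s - v))
        + (K31 * K43 + K32 * K44 + K13 * K21 + K14 * K22) * Real.exp (-(δ / 4 / n) * Beta.PoissonInterior.supNorm (s - v)))
      = (K11 * K23 * W₁ + K33 * K41 * W₁ + Real.exp (δ / 4) * (K12 * K24) * W₁ + Real.exp (δ / 4) * (K34 * K42) * W₁)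
        + (K31 * K43 * W₀ + K32 * K44 * W₀ + K13 * K21 * W₀ + K14 * K22 * W₀) := by
    have e : ∀ s : Pt, |qJet n κ u (blk m u) s| *
        ((K11 * K23 + K33 * K41 + Real.exp (δ / 4) * (K12 * K24 + K34 * K42)) *
            (Real.exp (-(δ / 4 / n) * Beta.PoissonInterior.supNorm (s - v)) / nrm (s - v))
          + (K31 * K43 + K32 * K44 + K13 * K21 + K14 * K22) * Real.exp (-(δ / 4 / n) * Beta.PoissonInterior.supNorm (s - v)))
        = (K11 * K23 + K33 * K41 + Real.exp (δ / 4) * (K12 * K24 + K34 * K42)) *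
            (|qJet n κ u (blk m u) s| * (Real.exp (-(δ / 4 / n) * Beta.PoissonInterior.supNorm (s - v)) / nrm (s - v)))
          + (K31 * K43 + K32 * K44 + K13 * K21 + K14 * K22) *
            (|qJet n κ u (blk m u) s| * Real.exp (-(δ / 4 / n) * Beta.PoissonInterior.supNorm (s - v))) := fun s => by ring
    rw [Finset.sum_congr rfl fun s _ => e s, Finset.sum_add_distrib, ← Finset.mul_sum, ← Finset.mul_sum, ← hW₁, ← hW₀]
    ring
  -- `|−½·X| ≤ |X|`, then the sixteen-term triangle inequality
  rw [abs_mul, abs_neg]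
  refine (mul_le_of_le_one_left (abs_nonneg _) (by rw [abs_of_pos (by norm_num : (0 : ℝ) < 1 / 2)]; norm_num)).trans ?_
  refine (abs_comb8_le _ _ _ _ _ _ _ _ _ _ _ _ _ _ _ _).trans ?_
  rw [hRHS]
  linarith [r1, r2, r3, r4, r5, r6, r7, r8]

end Word

end Summit.QuantumFields.BalabanUV.Beta.D1BFx.NeedleNdlDipWord

end
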